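import Summits.BirchSwinnertonDyer.BirchSwinnertonDyer.Theorems.GenusKolyvaginAtTwoGenusPrimitiveSupplyAtTwoTwistRamifiedTransversalRat
import Summits.BirchSwinnertonDyer.BirchSwinnertonDyer.Theorems.GenusKolyvaginAtTwoGenusPrimitiveSupplyAtTwoPrimeHeegnerTwin
import Summits.BirchSwinnertonDyer.BirchSwinnertonDyer.Theorems.GenusKolyvaginAtTwoGenusPrimitiveSupplyAtTwoTwistingPrimeLocal
import Literature.NumberTheory.EllipticCurves.Castella2018.TamagawaQuadraticBaseChangeProofs
import Literature.NumberTheory.EllipticCurves.TwoDescentLocalExhibits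
import Literature.NumberTheory.EllipticCurves.PAdicGrossZagierConstantTermProofs
import Literature.NumberTheory.EllipticCurves.ModularityVersionApProofs
import Literature.NumberTheory.EllipticCurves.NoEverywhereGoodReductionRat
import Literature.NumberTheory.EllipticCurves.CasselsTateSelmerKolyvaginValue
import HarnessLib

/-!
# Route `GenusKolyvaginAtTwo`, crux #2 `GenusPrimitiveSupplyAtTwo` (stmt-BirchSwinnertonDyer-22136):
# the `ℚ`-INSTANCE of the place menu — Mazur–Rubin Cor. 3.4 (i) DOWN for the prime Heegner twin `E^{(−ℓ)}`,
# as a KERNEL theorem modulo Poitou–Tate duality and Tate's local Euler characteristic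

Width seat `bsd-line-gk2-p5` g8 (cell `bsd-f1-sign2`, SUPPLY lineage), tenth file of the series (crux workfile
`Lines/genus-supply-mr-instantiation.md`); the `ℚ`-instance the lead (gk2-p1 g7, 09:40Z) asked this seat for. THEOREMS ONLY
(no definition, no named fact, no `sorry`); helper `--supports stmt-BirchSwinnertonDyer-22136`; no item is closed; BSD is not
proved by any of this.

WHAT. The lineage's capstones (`GenusKolyTwin.cor34i_twin_prime_heegner`, gk2-p4's
`exists_kolyvaginPrime_pow_genusPair_selmer_of_cor34i`) consume the PRINT named fact `MazurRubin2010.cor34i_singleton_rat` (`h34`).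
Its DOWN half — «if `Sel₂(E)` is NOT strict at the ramified prime `ℓ` then `#Sel₂(E) = 2 · #Sel₂(E^{(d_K)})`» — is here a kernel
theorem CONDITIONAL only on the two displayed print facts `poitouTate_selmerStructure_duality_real ℚ` (Milne I.4.10) and
`localEulerPoincareCharacteristic` (Tate, Milne I.2.8), in EXACTLY the capstone's currency
(`natCard_selmerGroup_eq_two_mul_of_not_le_strictLocalKer`): `W/ℚ` globally minimal with `Δ_W < 0`, `K = ℚ(√−ℓ)` a prime Heegner
field for `N_W` with `d_K = −ℓ` odd and `2` split, `Wd` any elliptic model of `W^{(d_K)}`, and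
`¬ Sel₂(W) ≤ MazurRubin2010.strictLocalKer W ℚ_ℓ 2`. It is the number-field theorem
`GenusKolyTwistRamified.natCard_selmerGroup_twist_mul_two_eq_of_places` (lead, p622198; = this seat's
`natCard_selmerGroup_twist_mul_two_eq_of_local`, p620693, with Lemma 2.11 discharged) with its PLACE MENU discharged over `ℚ`:
* finite `v ≠ (ℓ)` over a prime `p ∣ 2N_W`: `p` splits in `K` (Heegner hypothesis / `2` split), so `d_K ∈ (ℚ_p^×)²`
  (`Castella2018.TamagawaQuadratic.isSquare_padic_discr_of_splitsIn`, transported to `ℚ_v` along Mathlib's `padicEquiv`);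
* finite `v ≠ (ℓ)` over `p ∤ 2N_W`: `W` and `Wd` both have good reduction at `v` (`hasGoodReductionAt_quadraticTwist`);
* the real place: `Δ_W < 0` and `Δ_{Wd} = u⁻¹²d_K⁶Δ_W < 0`, so `H¹(ℝ, W) = H¹(ℝ, Wd) = 0` (gk2-p3's `ArchVanishing`);
* at `v₀ = (ℓ)`: `v₀(d_K) = 1` (lead's `valuation_neg_natCast_eq_exp_neg_one_of_mem`), `#W(ℚ_ℓ)[2] = 2`
  (`GenusKolyTwin.natCard_twoTorsion_padic_eq_two_of_discr_eq_neg_prime`, transported to `ℚ_{v₀}` by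
  `natCard_ker_nsmul_adicCompletion_eq_padic`), and the non-strict Selmer class localises non-trivially at `v₀`
  (`exists_selmer_localization_ne_zero_of_not_le_strictLocalKer`: `strictLocalKer = torsionLocalKer` is invariant under
  `ℚ_{v₀} ≃ ℚ_ℓ` and is the kernel of the genuine localisation).

References: [MazurRubin2010] Prop. 3.3, Cor. 3.4 (i), Lemmas 2.10–2.11; [MilneADT2006] I Thm. 2.8, I Thm. 4.10;
[SilvermanAEC2009] VII.5 Prop. 5.1, X.1; [NeukirchANT1999] I (8.5).
-/

set_option linter.dupNamespace false -- tree convention: `Summit.BirchSwinnertonDyer.BirchSwinnertonDyer.Theorems` (summit = sub-problem)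
set_option autoImplicit false

noncomputable section

open scoped Classical ContRepresentation

namespace Summit.BirchSwinnertonDyer.BirchSwinnertonDyer.Theorems.GenusKolyTwistLocal

open WeierstrassCurve Field NumberField IsDedekindDomain Function
open Literature.NumberTheory.EllipticCurves Literature.NumberTheory.GaloisRepresentations
open Literature.NumberTheory.GaloisCohomology
open Rat.HeightOneSpectrum (primesEquiv natGenerator)

variable (W : WeierstrassCurve ℚ)

/-! ## §23 Rational points of `W` over `ℚ`-isomorphic fields: `#W(ℚ_v)[n] = #W(ℚ_p)[n]` -/

/-- A `ℚ`-algebra endomorphism of a field that is pointwise the identity acts as the identity on `W(E)`. [folklore] -/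
theorem point_map_eq_self_of_forall_eq {E : Type*} [Field E] [Algebra ℚ E] (f : E →ₐ[ℚ] E) (hf : ∀ x, f x = x)
    (P : (W.baseChange E).toAffine.Point) : Affine.Point.map (W' := W.toAffine) f P = P := by
  rcases P with _ | @⟨x, y, h⟩
  · rfl
  · rw [Affine.Point.map_some]
    simp only [Affine.Point.some.injEq]
    exact ⟨hf x, hf y⟩

/-- **`#W(E)[n] = #W(E')[n]` for `ℚ`-isomorphic fields `E ≃ₐ[ℚ] E'`** (transport of points along the isomorphism and its
inverse, Mathlib's `Affine.Point.map`). [folklore] -/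
theorem natCard_ker_nsmul_eq_of_algEquiv {E E' : Type*} [Field E] [Field E'] [Algebra ℚ E] [Algebra ℚ E']
    (e : E ≃ₐ[ℚ] E') (n : ℕ) :
    Nat.card (nsmulAddMonoidHom n : (W.baseChange E).toAffine.Point →+ _).ker =
      Nat.card (nsmulAddMonoidHom n : (W.baseChange E').toAffine.Point →+ _).ker := by
  set Φ : (W.baseChange E).toAffine.Point →+ (W.baseChange E').toAffine.Point :=
    Affine.Point.map (W' := W.toAffine) (e : E →ₐ[ℚ] E') with hΦ
  set Ψ : (W.baseChange E').toAffine.Point →+ (W.baseChange E).toAffine.Point :=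
    Affine.Point.map (W' := W.toAffine) (e.symm : E' →ₐ[ℚ] E) with hΨ
  have hΨΦ : ∀ P, Ψ (Φ P) = P := fun P ↦ by
    rw [hΦ, hΨ, Affine.Point.map_map]
    exact point_map_eq_self_of_forall_eq W _ (fun x ↦ e.symm_apply_apply x) P
  have hΦΨ : ∀ Q, Φ (Ψ Q) = Q := fun Q ↦ by
    rw [hΦ, hΨ, Affine.Point.map_map]
    exact point_map_eq_self_of_forall_eq W _ (fun x ↦ e.apply_symm_apply x) Q
  let Θ : (W.baseChange E).toAffine.Point ≃ (W.baseChange E').toAffine.Point :=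
    { toFun := Φ, invFun := Ψ, left_inv := hΨΦ, right_inv := hΦΨ }
  refine Nat.card_congr (Θ.subtypeEquiv fun P ↦ ?_)
  change n • P = 0 ↔ n • Φ P = 0
  rw [← map_nsmul]
  constructor
  · intro h
    rw [h, map_zero]
  · intro h
    rw [← hΨΦ (n • P), h, map_zero]

/-- **`#W(ℚ_v)[n] = #W(ℚ_p)[n]`**, `p` the prime under the finite place `v` of `ℚ`, `ℚ_v = v.adicCompletion ℚ` the tree's
completion and `ℚ_p = ℚ_[p]` Mathlib's (along Mathlib's `ℚ`-algebra isomorphism `padicEquiv v : ℚ_v ≃ ℚ_p`). [folklore] -/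
theorem natCard_ker_nsmul_adicCompletion_eq_padic (v : HeightOneSpectrum (𝓞 ℚ)) (n : ℕ) :
    Nat.card (nsmulAddMonoidHom n : (W.baseChange (v.adicCompletion ℚ)).toAffine.Point →+ _).ker =
      haveI := Fact.mk (primesEquiv v).2
      Nat.card {Q : (W.baseChange ℚ_[((primesEquiv v : Nat.Primes) : ℕ)]).toAffine.Point // n • Q = 0} := by
  haveI := Fact.mk (primesEquiv v).2
  rw [natCard_ker_nsmul_eq_of_algEquiv W (Rat.HeightOneSpectrum.adicCompletion.padicEquiv (R := 𝓞 ℚ) v).toAlgEquiv n]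
  exact Nat.card_congr (Equiv.subtypeEquivRight fun Q ↦ Iff.rfl)

/-! ## §24 The non-strict Selmer class localises non-trivially at `v` -/

/-- **Strict vanishing = kernel of the genuine localisation** at a finite place `v` of `ℚ`, level `2`:
`x ∈ torsionLocalKer_v ⟺ loc_v x = 0` (tree `mem_torsionLocalKer_iff_res_eq_zero`; `loc_v` IS `res` to `ℚ_v` by definition).
[cite: McCallumLMS1991, §3 (3)] [cite: SilvermanAEC2009, Cor. III.6.4(b)] -/
theorem mem_torsionLocalKer_iff_localization_eq_zero_rat [W.IsElliptic] (v : HeightOneSpectrum (𝓞 ℚ))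
    (x : W.galH1Torsion ((2 : ℕ) : ℤ)) :
    x ∈ W.torsionLocalKer (v.adicCompletion ℚ) ((2 : ℕ) : ℤ) ↔
      galoisCohomology.localization (W.torsionGaloisModule ((2 : ℕ) : ℤ)) (Sum.inr v) 1 x = 0 := by
  -- pin Mathlib's `ℚ`-algebra structure on `ℚ_v` BEFORE adding `CharZero ℚ_v` (which would let instance search find the
  -- generic `DivisionRing.toRatAlgebra` instead — equal by `Subsingleton (Algebra ℚ _)`, but not definitionally)
  letI : Algebra ℚ (v.adicCompletion ℚ) := inferInstance
  haveI : CharZero (v.adicCompletion ℚ) :=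
    Literature.NumberTheory.GaloisRepresentations.charZero_adicCompletion v
  exact mem_torsionLocalKer_iff_res_eq_zero W (v.adicCompletion ℚ) (k := 2) two_ne_zero x


/-- **`¬ Sel₂(W) ≤ strictLocalKer W ℚ_p 2` gives a `2`-Selmer class with `loc_v ≠ 0`** (`v` the place over `p`):
`MazurRubin2010.strictLocalKer = torsionLocalKer` (definitional) is invariant under the ring isomorphism `ℚ_v ≃ ℚ_p`
(`GenusKolyTwistingPrime.mem_torsionLocalKer_padic_iff`) and is the kernel of the genuine localisation
(`mem_torsionLocalKer_iff_res_eq_zero`); `Sel₂ = ` the Selmer group of the Kummer Selmer structure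
(`selmerGroup_eq_selmerGroup_kummerSelmerStructure`). [cite: MazurRubin2010, Def. 3.1] [cite: McCallumLMS1991, §3 (3)] -/
theorem exists_selmer_localization_ne_zero_of_not_le_strictLocalKer [W.IsElliptic] (v : HeightOneSpectrum (𝓞 ℚ))
    (h : haveI := Fact.mk (primesEquiv v).2
      ¬ W.selmerGroup 2 ≤ MazurRubin2010.strictLocalKer W ℚ_[((primesEquiv v : Nat.Primes) : ℕ)] 2) :
    ∃ c ∈ (W.kummerSelmerStructure ((2 : ℕ) : ℤ)).selmerGroup,
      galoisCohomology.localization (W.torsionGaloisModule ((2 : ℕ) : ℤ)) (Sum.inr v) 1 c ≠ 0 := by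
  haveI := Fact.mk (primesEquiv v).2
  letI : Algebra ℚ (v.adicCompletion ℚ) := inferInstance
  haveI : CharZero (v.adicCompletion ℚ) :=
    Literature.NumberTheory.GaloisRepresentations.charZero_adicCompletion v
  -- `strictLocalKer = torsionLocalKer` (definitional), at level `((2 : ℕ) : ℤ)`
  have h' : ¬ W.selmerGroup ((2 : ℕ) : ℤ) ≤
      W.torsionLocalKer ℚ_[((primesEquiv v : Nat.Primes) : ℕ)] ((2 : ℕ) : ℤ) := h
  obtain ⟨c, hcS, hc⟩ := SetLike.not_le_iff_exists.mp h'
  refine ⟨c, ?_, fun h0 ↦ hc ?_⟩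
  · rw [← selmerGroup_eq_selmerGroup_kummerSelmerStructure]
    exact hcS
  · have h1 : c ∈ W.torsionLocalKer (v.adicCompletion ℚ) ((2 : ℕ) : ℤ) :=
      (mem_torsionLocalKer_iff_localization_eq_zero_rat W v c).mpr h0
    exact (GenusKolyTwistingPrime.mem_torsionLocalKer_padic_iff W
      (RingEquivClass.toRingEquiv (Rat.HeightOneSpectrum.adicCompletion.padicEquiv (R := 𝓞 ℚ) v))
      ((2 : ℕ) : ℤ) c).mpr h1

/-! ## §25 The place menu over `ℚ` for a Heegner twin -/

/-- **Good reduction of a model of the twist away from `2 d N_W`**: `W/ℚ` globally minimal, `v` over a prime `p ∤ 2d` of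
good reduction for `W`, `C • W^{(d)} = Wd` ⟹ `Wd` has good reduction at `v` (Silverman VII.5.1: good reduction is a property
of the isomorphism class; `W^{(d)}` is `v`-integral with unit discriminant `d⁶Δ_min`).
[cite: SilvermanAEC2009, VII.1 Rem. 1.1, VII.5 Prop. 5.1 (a)] -/
theorem hasGoodReductionAt_of_smul_quadraticTwist [W.IsElliptic] [W.IsGloballyMinimal] (v : HeightOneSpectrum (𝓞 ℚ))
    {d : ℤ} (hpd : ¬ (((primesEquiv v : Nat.Primes) : ℕ) : ℤ) ∣ 2 * d) (hW : W.HasGoodReductionAt v)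
    {Wd : WeierstrassCurve ℚ} {C : VariableChange ℚ} (hC : C • W.quadraticTwist (d : ℚ) = Wd) :
    Wd.HasGoodReductionAt v := by
  haveI := Fact.mk (primesEquiv v).2
  have hN : ¬ ((primesEquiv v : Nat.Primes) : ℕ) ∣ W.conductorNorm ℤ := fun h ↦
    ((W.dvd_conductorNorm_iff v).mp h) hW
  have hΔ : ¬ (((primesEquiv v : Nat.Primes) : ℕ) : ℤ) ∣ minimalDiscriminantInt W := fun h ↦
    hN (GenusKolyTwin.dvd_conductorNorm_of_dvd_minimalDiscriminantInt W (primesEquiv v).2 h)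
  have htw : (W.quadraticTwist (d : ℚ)).HasGoodReductionAt v := hasGoodReductionAt_quadraticTwist W v hpd hΔ
  rw [← hC, ← hasGoodReductionAtPrime_iff_hasGoodReductionAt_ringOfIntegers v,
    hasGoodReductionAtPrime_iff_of_variableChange]
  exact (hasGoodReductionAtPrime_iff_hasGoodReductionAt_ringOfIntegers v _).mpr htw

/-- **A prime split in the quadratic field `K` makes `d_K` a square in the tree's completion `ℚ_v`** (`v` over `p`):
`Castella2018.TamagawaQuadratic.isSquare_padic_discr_of_splitsIn` transported along `padicEquiv`.
[cite: NeukirchANT1999, Ch. I (8.5)] -/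
theorem exists_sq_eq_discr_adicCompletion_of_ncard_primesOver {K : Type} [Field K] [NumberField K]
    (h2 : Module.finrank ℚ K = 2) (v : HeightOneSpectrum (𝓞 ℚ))
    (hs : ((Ideal.span {((((primesEquiv v : Nat.Primes) : ℕ) : ℤ))}).primesOver (𝓞 K)).ncard = 2) :
    ∃ s : v.adicCompletion ℚ, s ^ 2 = algebraMap ℚ (v.adicCompletion ℚ) (discr K : ℚ) := by
  haveI := Fact.mk (primesEquiv v).2
  have hsq : IsSquare ((discr K : ℚ) : ℚ_[((primesEquiv v : Nat.Primes) : ℕ)]) :=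
    Castella2018.TamagawaQuadratic.isSquare_padic_discr_of_splitsIn h2 hs
  obtain ⟨s, hs⟩ := TwoDescentLocal.isSquare_algebraMap_adicCompletion_of_padic v hsq
  exact ⟨s, by rw [sq]; exact hs.symm⟩

/-- **The finite place menu over `ℚ` for a Heegner twin.** `W/ℚ` globally minimal, `K` quadratic, Heegner for `N_W` with `2`
split, `ℓ` a prime with `d_K = −ℓ`, `v₀` the place over `ℓ`, `C • W^{(d_K)} = Wd`: every finite `v ≠ v₀` is split in `K`
(if over `p ∣ 2N_W`) or odd and good for both `W` and `Wd` (if over `p ∤ 2N_W`).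
[cite: MazurRubin2010, Prop. 3.3 (hypotheses), Lemma 2.10 (i)–(ii)] [cite: GrossLMS1991, §1 (p. 235)] -/
theorem twist_place_menu_finite_rat [W.IsElliptic] [W.IsGloballyMinimal] {K : Type} [Field K] [NumberField K]
    (h2 : Module.finrank ℚ K = 2) (hH : SatisfiesHeegnerHypothesis (W.conductorNorm ℤ) K)
    (h2K : ((Ideal.span {(2 : ℤ)}).primesOver (𝓞 K)).ncard = 2) {ℓ : ℕ} (hℓ : ℓ.Prime) (hd : discr K = -(ℓ : ℤ))
    {v₀ : HeightOneSpectrum (𝓞 ℚ)} (hv₀ : (ℓ : 𝓞 ℚ) ∈ v₀.asIdeal)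
    {Wd : WeierstrassCurve ℚ} {C : VariableChange ℚ} (hC : C • W.quadraticTwist (discr K : ℚ) = Wd) :
    ∀ v : HeightOneSpectrum (𝓞 ℚ), v ≠ v₀ →
      (∃ s : v.adicCompletion ℚ, s ^ 2 = algebraMap ℚ (v.adicCompletion ℚ) (discr K : ℚ)) ∨
      (((2 : ℕ) : 𝓞 ℚ) ∉ v.asIdeal ∧ W.HasGoodReductionAt v ∧ Wd.HasGoodReductionAt v) ∨
      (((2 : ℕ) : 𝓞 ℚ) ∉ v.asIdeal ∧
        Nat.card (nsmulAddMonoidHom 2 : (W.baseChange (v.adicCompletion ℚ)).toAffine.Point →+ _).ker = 1 ∧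
        Nat.card (nsmulAddMonoidHom 2 : (Wd.baseChange (v.adicCompletion ℚ)).toAffine.Point →+ _).ker = 1) := by
  intro v hv
  haveI := Fact.mk (primesEquiv v).2
  set p : ℕ := ((primesEquiv v : Nat.Primes) : ℕ) with hp
  have hpP : p.Prime := (primesEquiv v).2
  have hpv : (p : 𝓞 ℚ) ∈ v.asIdeal := Rat.HeightOneSpectrum.natCast_natGenerator_mem v
  by_cases hsplit : p ∣ W.conductorNorm ℤ ∨ p = 2
  · -- `p` splits in `K`: `d_K` is a square in `ℚ_v`
    refine Or.inl (exists_sq_eq_discr_adicCompletion_of_ncard_primesOver h2 v ?_)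
    rcases hsplit with hpN | hp2
    · exact hH p hpP hpN
    · rw [← hp, hp2]
      exact h2K
  · -- `p ∤ 2 N_W`: odd, good for `W` and for `Wd`
    rw [not_or] at hsplit
    obtain ⟨hpN, hp2⟩ := hsplit
    have h2v : ((2 : ℕ) : 𝓞 ℚ) ∉ v.asIdeal :=
      GenusKolyTwistingPrime.natCast_not_mem_of_not_dvd hpP hpv fun h ↦
        hp2 ((Nat.prime_dvd_prime_iff_eq hpP Nat.prime_two).mp h)
    have hW : W.HasGoodReductionAt v := by
      by_contra h
      exact hpN ((W.dvd_conductorNorm_iff v).mpr h)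
    have hpℓ : p ≠ ℓ := by
      rintro hpℓ
      rw [hpℓ] at hpv
      exact hv (Literature.NumberTheory.EllipticCurves.HeightOneSpectrum.eq_of_natCast_mem_rat hℓ hpv hv₀)
    have hpd : ¬ ((p : ℕ) : ℤ) ∣ 2 * discr K := by
      rw [hd, mul_neg, dvd_neg]
      intro h
      rcases (Nat.prime_iff_prime_int.mp hpP).dvd_or_dvd h with h2' | hℓ'
      · exact hp2 ((Nat.prime_dvd_prime_iff_eq hpP Nat.prime_two).mp (by exact_mod_cast h2'))
      · exact hpℓ ((Nat.prime_dvd_prime_iff_eq hpP hℓ).mp (by exact_mod_cast hℓ'))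
    exact Or.inr (Or.inl ⟨h2v, hW, hasGoodReductionAt_of_smul_quadraticTwist W v hpd hW hC⟩)

/-- **The discriminant of a model of a quadratic twist has the sign of `Δ_W`**: `C • W^{(d)} = Wd`, `d ≠ 0`, `Δ_W < 0` ⟹
`Δ_{Wd} = u⁻¹² d⁶ Δ_W < 0`. [cite: SilvermanAEC2009, X.5 Cor. 5.4, III.1 Table 3.1] -/
theorem Δ_neg_of_smul_quadraticTwist {d : ℚ} (hd : d ≠ 0) (hΔ : W.Δ < 0) {Wd : WeierstrassCurve ℚ}
    {C : VariableChange ℚ} (hC : C • W.quadraticTwist d = Wd) : Wd.Δ < 0 := by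
  rw [← hC, variableChange_Δ, quadraticTwist_Δ]
  have hu : (0 : ℚ) < ((C.u⁻¹ : ℚˣ) : ℚ) ^ 12 := by
    rw [show (12 : ℕ) = 2 * 6 from rfl, pow_mul]
    exact pow_pos (lt_of_le_of_ne (sq_nonneg _) (Ne.symm (pow_ne_zero 2 (Units.ne_zero _)))) 6
  have hd6 : (0 : ℚ) < d ^ 6 := by
    rw [show (6 : ℕ) = 2 * 3 from rfl, pow_mul]
    exact pow_pos (lt_of_le_of_ne (sq_nonneg _) (Ne.symm (pow_ne_zero 2 hd))) 3
  exact mul_neg_of_pos_of_neg hu (mul_neg_of_pos_of_neg hd6 hΔ)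

/-- **The archimedean place menu over `ℚ` on `Δ_W < 0`**: `H¹(ℝ, W) = H¹(ℝ, Wd) = 0` for every model `Wd` of a quadratic
twist of `W` (both discriminants are negative; gk2-p3's `ArchVanishing.localH1_infinitePlace_eq_zero_of_Δ_neg`).
[cite: MazurRubin2010, Lemma 2.10 (iv)] [cite: MilneADT2006, I Rem. 3.7] -/
theorem twist_place_menu_infinite_rat [W.IsElliptic] (hΔ : W.Δ < 0) {d : ℚ} (hd : d ≠ 0)
    {Wd : WeierstrassCurve ℚ} [Wd.IsElliptic] {C : VariableChange ℚ} (hC : C • W.quadraticTwist d = Wd) :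
    ∀ w : InfinitePlace ℚ,
      (∃ s : w.Completion, s ^ 2 = algebraMap ℚ w.Completion d) ∨
      ((∀ x : galoisCohomology (W.localGaloisModule w.Completion) 1, x = 0) ∧
        (∀ x : galoisCohomology (Wd.localGaloisModule w.Completion) 1, x = 0)) :=
  fun w ↦ Or.inr ⟨fun x ↦ GenusExact.ArchVanishing.localH1_infinitePlace_eq_zero_of_Δ_neg W w hΔ x,
    fun x ↦ GenusExact.ArchVanishing.localH1_infinitePlace_eq_zero_of_Δ_neg Wd w
      (Δ_neg_of_smul_quadraticTwist W hd hΔ hC) x⟩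

/-! ## §26 Corollary 3.4 (i) DOWN for the prime Heegner twin over `ℚ`, in the capstones' currency -/

/-- **MAZUR–RUBIN COR. 3.4 (i), DOWN DIRECTION, FOR THE PRIME HEEGNER TWIN — KERNEL THEOREM modulo Poitou–Tate duality and
Tate's local Euler characteristic** (the DOWN half of the print named fact `MazurRubin2010.cor34i_singleton_rat` as consumed by
`GenusKolyTwin.cor34i_twin_prime_heegner` / gk2-p4's `exists_kolyvaginPrime_pow_genusPair_selmer_of_cor34i`, same currency).
Let `W/ℚ` be globally minimal elliptic with `Δ_W < 0`, `K` imaginary quadratic with `d_K = −ℓ` odd (`ℓ` prime), Heegner for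
`N_W`, `2` split in `K`, `Wd` an elliptic model of `W^{(d_K)}`. IF `Sel₂(W)` is NOT strict at `ℓ`
(`¬ Sel₂(W) ≤ MazurRubin2010.strictLocalKer W ℚ_ℓ 2`, i.e. some `2`-Selmer class has `loc_ℓ ≠ 0`), THEN
`#Sel₂(W) = 2 · #Sel₂(Wd)`. CONDITIONAL on the displayed hypotheses `hPT : poitouTate_selmerStructure_duality_real ℚ`
(Milne I Thm. 4.10) and `hEP : ∀ v, localEulerPoincareCharacteristic ℚ_v` (Milne I Thm. 2.8) ONLY — Lemmas 2.10 (i), (ii), (iv),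
2.11 and Prop. 3.3's count are kernel theorems of this series and the lead's p622198.
[cite: MazurRubin2010, Prop. 3.3, Cor. 3.4 (i), Lemmas 2.10–2.11] [cite: MilneADT2006, I Thm. 2.8, I Thm. 4.10]
[cite: GrossLMS1991, §1 (p. 235)] -/
theorem natCard_selmerGroup_eq_two_mul_of_not_le_strictLocalKer [W.IsElliptic] [W.IsGloballyMinimal]
    {K : Type} [Field K] [NumberField K]
    (hPT : poitouTate_selmerStructure_duality_real ℚ)
    (hEP : ∀ v : HeightOneSpectrum (𝓞 ℚ), localEulerPoincareCharacteristic (v.adicCompletion ℚ))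
    (hΔ : W.Δ < 0) (hK : IsImaginaryQuadratic K) (hodd : Odd (discr K))
    (hH : SatisfiesHeegnerHypothesis (W.conductorNorm ℤ) K) (h2K : ((Ideal.span {(2 : ℤ)}).primesOver (𝓞 K)).ncard = 2)
    {ℓ : ℕ} [Fact ℓ.Prime] (hd : discr K = -(ℓ : ℤ)) (Wd : WeierstrassCurve ℚ) [Wd.IsElliptic]
    (hWd : ∃ C : VariableChange ℚ, C • W.quadraticTwist (discr K : ℚ) = Wd)
    (hns : ¬ W.selmerGroup 2 ≤ MazurRubin2010.strictLocalKer W ℚ_[ℓ] 2) :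
    Nat.card (W.selmerGroup 2) = 2 * Nat.card (Wd.selmerGroup 2) := by
  have hℓ : ℓ.Prime := Fact.out
  obtain ⟨hℓ2, hℓN, -⟩ := GenusKolyTwin.prime_discr_facts W hK hodd hH hℓ hd
  -- the place `v₀` of `ℚ` over `ℓ`
  obtain ⟨v₀, hv₀⟩ : ∃ v : HeightOneSpectrum (𝓞 ℚ), ((primesEquiv v : Nat.Primes) : ℕ) = ℓ :=
    ⟨primesEquiv.symm ⟨ℓ, hℓ⟩, by rw [Equiv.apply_symm_apply]⟩
  have hℓv₀ : (ℓ : 𝓞 ℚ) ∈ v₀.asIdeal := by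
    rw [← hv₀]
    exact Rat.HeightOneSpectrum.natCast_natGenerator_mem v₀
  obtain ⟨C, hC⟩ := hWd
  have hd0 : (discr K : ℚ) ≠ 0 := by
    rw [hd]
    push_cast
    exact neg_ne_zero.mpr (by exact_mod_cast hℓ.ne_zero)
  -- `W` good at `v₀`, `v₀ ∤ 2`
  have hW : W.HasGoodReductionAt v₀ := by
    by_contra h
    exact hℓN (hv₀ ▸ (W.dvd_conductorNorm_iff v₀).mpr h)
  have h2v₀ : ((2 : ℕ) : 𝓞 ℚ) ∉ v₀.asIdeal :=
    GenusKolyTwistingPrime.natCast_not_mem_of_not_dvd hℓ hℓv₀ fun h ↦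
      hℓ2 ((Nat.prime_dvd_prime_iff_eq hℓ Nat.prime_two).mp h)
  -- `v₀(d_K) = 1`
  have hram : ∃ π c : ℚ, v₀.valuation ℚ π = WithZero.exp (-1 : ℤ) ∧ (discr K : ℚ) = c ^ 2 * π :=
    ⟨(discr K : ℚ), 1, by
      rw [hd]
      push_cast
      exact GenusKolyTwistRamified.valuation_neg_natCast_eq_exp_neg_one_of_mem v₀ hℓ hℓv₀,
      by rw [one_pow, one_mul]⟩
  -- `#W(ℚ_{v₀})[2] = 2`
  have ht : Nat.card (nsmulAddMonoidHom 2 :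
      (W.baseChange (v₀.adicCompletion ℚ)).toAffine.Point →+ _).ker = 2 := by
    rw [natCard_ker_nsmul_adicCompletion_eq_padic W v₀ 2]
    subst hv₀
    exact GenusKolyTwin.natCard_twoTorsion_padic_eq_two_of_discr_eq_neg_prime W hK hodd hH hd hΔ
  -- the non-strict class
  have hns' : ∃ c ∈ (W.kummerSelmerStructure ((2 : ℕ) : ℤ)).selmerGroup,
      galoisCohomology.localization (W.torsionGaloisModule ((2 : ℕ) : ℤ)) (Sum.inr v₀) 1 c ≠ 0 := by
    apply exists_selmer_localization_ne_zero_of_not_le_strictLocalKer W v₀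
    subst hv₀
    exact hns
  have h := GenusKolyTwistRamified.natCard_selmerGroup_twist_mul_two_eq_of_places W hPT hEP hd0 hC v₀ h2v₀ hW
    hram (twist_place_menu_finite_rat W hK.1 hH h2K hℓ hd hℓv₀ hC)
    (twist_place_menu_infinite_rat W hΔ hd0 hC) ht hns'
  change Nat.card (Wd.selmerGroup 2) * 2 = Nat.card (W.selmerGroup 2) at h
  omega

end Summit.BirchSwinnertonDyer.BirchSwinnertonDyer.Theorems.GenusKolyTwistLocal

end
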